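import Summits.AtomisticToContinuum.FouriersLaw.Theorems.LocalOhmBVBVProfileTotalBackflowSeam

/-!
# Crux `BVProfile` (item stmt-AtomisticToContinuum-12012), line `registered`: the seam of the RESHAPED two-stub cut
# "boundary-layer bound × bulk backflow ⇒ bounded variation", unconditionally

By the landed one-stub seam (`bvProfile_of_totalBackflow`, `Theorems/LocalOhmBVBVProfileTotalBackflowSeam.lean`:
`TV = drop + 2·(total backflow)`, drop `≤ 1` by the contact passivity `profileBound_contact`), the crux needs only an
`N`-uniform bound on the TOTAL backflow. That splits along the registered bulk/boundary cut WITHOUT any sup bound in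
the bulk:

* BULK BACKFLOW (`stub_boundedBackflow`, registered, unchanged): `∃ ℓ K`, `Σ_{ℓ ≤ i, i+1+ℓ < N} (θ(i+1) − θ(i))⁺ ≤ K`;
* BOUNDARY-LAYER BOUND (`stub_boundaryBound`, NEW, replaces the everywhere sup bound `stub_profileBound`): for EVERY width
  `ℓ` there is `B` with `|t| ≤ B` for every `N`, every site `i` within `ℓ + 1` of an end (`i ≤ ℓ ∨ N ≤ i + 1 + ℓ`) and every
  limit `t` of the profile difference quotient at `i` — `N`-uniform boundedness of the response NEAR THE BATHS only.

`bvProfile_of_boundaryBound_of_backflow`: (boundary-bound statement) → (bulk-backflow statement) → (BVProfile statement),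
`C = 1 + 2·(max K 0 + 4ℓ·max B 0)`: the `≤ 2ℓ` non-bulk bonds climb at most `2·max B 0` each
(`totalBackflow_le_of_boundaryBound_of_backflow`), then the one-stub seam. The old sup-bound stub and the sister crux
`Passivity` imply the new boundary stub trivially (`boundaryBound_of_profileBound`, `boundaryBound_of_passivity`).
No definitions. [folklore]
-/

noncomputable section

open Finset

namespace Summit.AtomisticToContinuum.FouriersLaw.Theorems.BVProfileSeam

/-- **Bulk backflow + bounded boundary layers ⇒ total backflow.** If `|g k| ≤ B` at the boundary sites
(`k ≤ ℓ ∨ n ≤ k + ℓ`, `0 ≤ B`) and the positive increments over the bulk window `Ico ℓ (n - ℓ)` sum to at most `K`, then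
over `range n` they sum to at most `K + 4ℓB` (the `≤ 2ℓ` non-bulk increments are `≤ 2B` each; if `n < 2ℓ` every bond is
a boundary bond and `0 ≤ K`). [folklore] -/
theorem totalBackflow_le_of_boundaryBound_of_backflow (g : ℕ → ℝ) (n ℓ : ℕ) (B K : ℝ) (hB0 : 0 ≤ B)
    (hB : ∀ k, (k ≤ ℓ ∨ n ≤ k + ℓ) → |g k| ≤ B)
    (hK : (∑ k ∈ Ico ℓ (n - ℓ), max (g (k + 1) - g k) 0) ≤ K) :
    (∑ k ∈ range n, max (g (k + 1) - g k) 0) ≤ K + 4 * ℓ * B := by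
  -- a boundary bond climbs at most `2B`
  have hd : ∀ k, (k < ℓ ∨ n - ℓ ≤ k) → k < n → max (g (k + 1) - g k) 0 ≤ 2 * B := by
    intro k hk hkn
    have hk0 : k ≤ ℓ ∨ n ≤ k + ℓ := by omega
    have hk1 : k + 1 ≤ ℓ ∨ n ≤ (k + 1) + ℓ := by omega
    have h1 := abs_le.mp (hB (k + 1) hk1)
    have h2 := abs_le.mp (hB k hk0)
    exact max_le (by linarith [h1.2, h2.1]) (by linarith)
  have hedge : ∀ s : Finset ℕ, (∀ k ∈ s, (k < ℓ ∨ n - ℓ ≤ k) ∧ k < n) →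
      (∑ k ∈ s, max (g (k + 1) - g k) 0) ≤ (s.card : ℝ) * (2 * B) := by
    intro s hs
    have h := Finset.sum_le_card_nsmul s (fun k => max (g (k + 1) - g k) 0) (2 * B)
      (fun k hk => hd k (hs k hk).1 (hs k hk).2)
    simpa [nsmul_eq_mul] using h
  by_cases hℓ : ℓ ≤ n - ℓ
  · have hn : n - ℓ ≤ n := Nat.sub_le n ℓ
    have hsplit : (∑ k ∈ range n, max (g (k + 1) - g k) 0) =
        (∑ k ∈ Ico 0 ℓ, max (g (k + 1) - g k) 0) + (∑ k ∈ Ico ℓ (n - ℓ), max (g (k + 1) - g k) 0)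
          + ∑ k ∈ Ico (n - ℓ) n, max (g (k + 1) - g k) 0 := by
      rw [Finset.range_eq_Ico, ← Finset.sum_Ico_consecutive _ (Nat.zero_le (n - ℓ)) hn,
        ← Finset.sum_Ico_consecutive _ (Nat.zero_le ℓ) hℓ]
    have h1 : (∑ k ∈ Ico 0 ℓ, max (g (k + 1) - g k) 0) ≤ (ℓ : ℝ) * (2 * B) := by
      have h := hedge (Ico 0 ℓ) (fun k hk => by
        simp only [Finset.mem_Ico] at hk
        constructor <;> omega)
      have hc : ((Ico 0 ℓ).card : ℝ) = ℓ := by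
        rw [Nat.card_Ico]; norm_cast
      rw [hc] at h
      exact h
    have h3 : (∑ k ∈ Ico (n - ℓ) n, max (g (k + 1) - g k) 0) ≤ (ℓ : ℝ) * (2 * B) := by
      have h := hedge (Ico (n - ℓ) n) (fun k hk => by
        simp only [Finset.mem_Ico] at hk
        constructor <;> omega)
      have hc : ((Ico (n - ℓ) n).card : ℝ) = ℓ := by
        rw [Nat.card_Ico]; norm_cast; omega
      rw [hc] at h
      exact h
    rw [hsplit]
    linarith [h1, hK, h3]
  · rw [not_le] at hℓ
    have hK0 : 0 ≤ K := by
      rw [Finset.Ico_eq_empty_of_le hℓ.le, Finset.sum_empty] at hK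
      exact hK
    have hn : (n : ℝ) ≤ 2 * ℓ := by norm_cast; omega
    have h := hedge (range n) (fun k hk => by
      simp only [Finset.mem_range] at hk
      constructor <;> omega)
    rw [Finset.card_range] at h
    have h5 : (n : ℝ) * (2 * B) ≤ (2 * ℓ) * (2 * B) :=
      mul_le_mul_of_nonneg_right hn (by linarith)
    nlinarith [h, h5, hB0, hK0]

end Summit.AtomisticToContinuum.FouriersLaw.Theorems.BVProfileSeam

namespace Summit.AtomisticToContinuum.FouriersLaw.Theorems

open BVProfileSeam

/-- **Boundary-layer bound × bulk backflow ⇒ total backflow** (statements of the two registered stubs of the reshaped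
line → statement of `stub_totalBackflow`), with `K_total = max K 0 + 4ℓ·max B 0`: zero-extend the profile, take `B`
for the width `ℓ` delivered by the bulk stub, and apply `totalBackflow_le_of_boundaryBound_of_backflow` on `range (N−1)`.
[folklore] -/
theorem totalBackflow_of_boundaryBound_of_backflow : (∀ ω₂ lam β γ : ℝ, 0 < ω₂ → 0 < lam → 0 < β → 0 < γ → (∀ (N : ℕ) (T_L T_R : ℝ), 0 < T_L → 0 < T_R → ∀ μ ν : MeasureTheory.Measure (Literature.MathematicalPhysics.KineticTheory.HeatConduction.PhaseSpace N), (Literature.MathematicalPhysics.KineticTheory.HeatConduction.pinnedChain ω₂ lam β γ).IsSteadyState N T_L T_R μ → (Literature.MathematicalPhysics.KineticTheory.HeatConduction.pinnedChain ω₂ lam β γ).IsSteadyState N T_L T_R ν → μ = ν) → ∀ μ : (N : ℕ) → ℝ → ℝ → MeasureTheory.Measure (Literature.MathematicalPhysics.KineticTheory.HeatConduction.PhaseSpace N), (∀ (N : ℕ) (T_L T_R : ℝ), 0 < T_L → 0 < T_R → (Literature.MathematicalPhysics.KineticTheory.HeatConduction.pinnedChain ω₂ lam β γ).IsSteadyState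 N T_L T_R (μ N T_L T_R)) → ∀ T : ℝ, 0 < T → ∀ ℓ : ℕ, ∃ B : ℝ, ∀ (N : ℕ) (i : Fin N) (t : ℝ), (i.val ≤ ℓ ∨ N ≤ i.val + 1 + ℓ) → Filter.Tendsto (fun δ : ℝ => ((∫ x, (x.2 i) ^ 2 ∂(μ N (T + δ / 2) (T - δ / 2))) - ∫ x, (x.2 i) ^ 2 ∂(μ N T T)) / δ) (nhdsWithin 0 {(0 : ℝ)}ᶜ) (nhds t) → |t| ≤ B) → (∀ ω₂ lam β γ : ℝ, 0 < ω₂ → 0 < lam → 0 < β → 0 < γ → (∀ (N : ℕ) (T_L T_R : ℝ), 0 < T_L → 0 < T_R → ∀ μ ν : MeasureTheory.Measure (Literature.MathematicalPhysics.KineticTheory.HeatConduction.PhaseSpace N), (Literature.MathematicalPhysics.KineticTheory.HeatConduction.pinnedChain ω₂ lam β γ).IsSteadyState N T_L T_R μ → (Literature.MathematicalPhysics.KineticTheory.HeatConduction.pinnedChain ω₂ lam β γ).IsSteadyState N T_L T_R ν → μ = ν) → ∀ μ : (N : ℕ) → ℝ → ℝ → MeasureTheory.Measure (Literature.MathematicalPhysics.KineticTheory.HeatConduction.PhaseSpace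 N), (∀ (N : ℕ) (T_L T_R : ℝ), 0 < T_L → 0 < T_R → (Literature.MathematicalPhysics.KineticTheory.HeatConduction.pinnedChain ω₂ lam β γ).IsSteadyState N T_L T_R (μ N T_L T_R)) → ∀ T : ℝ, 0 < T → ∃ (ℓ : ℕ) (K : ℝ), ∀ (N : ℕ) (θ : Fin N → ℝ), (∀ i : Fin N, Filter.Tendsto (fun δ : ℝ => ((∫ x, (x.2 i) ^ 2 ∂(μ N (T + δ / 2) (T - δ / 2))) - ∫ x, (x.2 i) ^ 2 ∂(μ N T T)) / δ) (nhdsWithin 0 {(0 : ℝ)}ᶜ) (nhds (θ i))) → ∑ i : Fin N, ∑ j : Fin N, (if j.val = i.val + 1 ∧ ℓ ≤ i.val ∧ i.val + 1 + ℓ < N then max (θ j - θ i) 0 else 0) ≤ K) → (∀ ω₂ lam β γ : ℝ, 0 < ω₂ → 0 < lam → 0 < β → 0 < γ → (∀ (N : ℕ) (T_L T_R : ℝ), 0 < T_L → 0 < T_R → ∀ μ ν : MeasureTheory.Measure (Literature.MathematicalPhysics.KineticTheory.HeatConduction.PhaseSpace N), (Literature.MathematicalPhysics.KineticTheory.HeatConduction.pinnedChain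 ω₂ lam β γ).IsSteadyState N T_L T_R μ → (Literature.MathematicalPhysics.KineticTheory.HeatConduction.pinnedChain ω₂ lam β γ).IsSteadyState N T_L T_R ν → μ = ν) → ∀ μ : (N : ℕ) → ℝ → ℝ → MeasureTheory.Measure (Literature.MathematicalPhysics.KineticTheory.HeatConduction.PhaseSpace N), (∀ (N : ℕ) (T_L T_R : ℝ), 0 < T_L → 0 < T_R → (Literature.MathematicalPhysics.KineticTheory.HeatConduction.pinnedChain ω₂ lam β γ).IsSteadyState N T_L T_R (μ N T_L T_R)) → ∀ T : ℝ, 0 < T → ∃ K : ℝ, ∀ (N : ℕ) (θ : Fin N → ℝ), (∀ i : Fin N, Filter.Tendsto (fun δ : ℝ => ((∫ x, (x.2 i) ^ 2 ∂(μ N (T + δ / 2) (T - δ / 2))) - ∫ x, (x.2 i) ^ 2 ∂(μ N T T)) / δ) (nhdsWithin 0 {(0 : ℝ)}ᶜ) (nhds (θ i))) → ∑ i : Fin N, ∑ j : Fin N, (if j.val = i.val + 1 then max (θ j - θ i) 0 else 0) ≤ K) := by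
  intro hBB hBF ω₂ lam β γ hω hl hβ hγ hU μ hμ T hT
  obtain ⟨ℓ, K, hK⟩ := hBF ω₂ lam β γ hω hl hβ hγ hU μ hμ T hT
  obtain ⟨B, hB⟩ := hBB ω₂ lam β γ hω hl hβ hγ hU μ hμ T hT ℓ
  refine ⟨max K 0 + 4 * ℓ * max B 0, fun N θ hθ => ?_⟩
  set g : ℕ → ℝ := fun k => if h : k < N then θ ⟨k, h⟩ else 0 with hg_def
  have hg : ∀ i : Fin N, g i.val = θ i := fun i => by simp [hg_def, i.isLt]
  -- the boundary bound on the zero extension (sites `k ≤ ℓ ∨ N - 1 ≤ k + ℓ`)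
  have hgB : ∀ k, (k ≤ ℓ ∨ N - 1 ≤ k + ℓ) → |g k| ≤ max B 0 := by
    intro k hk
    by_cases hkN : k < N
    · rw [hg ⟨k, hkN⟩]
      refine (hB N ⟨k, hkN⟩ (θ ⟨k, hkN⟩) ?_ (hθ ⟨k, hkN⟩)).trans (le_max_left _ _)
      simp only
      omega
    · have h0 : g k = 0 := by simp [hg_def, hkN]
      rw [h0, abs_zero]
      exact le_max_right _ _
  have hKg : (∑ k ∈ Ico ℓ (N - 1 - ℓ), max (g (k + 1) - g k) 0) ≤ max K 0 := by
    rw [← backflow_sum_eq θ g hg ℓ]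
    exact (hK N θ hθ).trans (le_max_left _ _)
  rw [totalBackflow_sum_eq θ g hg]
  exact totalBackflow_le_of_boundaryBound_of_backflow g (N - 1) ℓ (max B 0) (max K 0) (le_max_right _ _) hgB hKg

/-- **The seam of the reshaped two-stub cut, UNCONDITIONAL**: (boundary-bound statement) → (bulk-backflow statement) →
(statement of `LocalOhmBV.BVProfile`, its definiens VERBATIM): total backflow by
`totalBackflow_of_boundaryBound_of_backflow`, then the landed one-stub seam `bvProfile_of_totalBackflow`
(`TV = drop + 2·backflow`, drop `≤ 1` by contact passivity). [folklore] -/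
theorem bvProfile_of_boundaryBound_of_backflow : (∀ ω₂ lam β γ : ℝ, 0 < ω₂ → 0 < lam → 0 < β → 0 < γ → (∀ (N : ℕ) (T_L T_R : ℝ), 0 < T_L → 0 < T_R → ∀ μ ν : MeasureTheory.Measure (Literature.MathematicalPhysics.KineticTheory.HeatConduction.PhaseSpace N), (Literature.MathematicalPhysics.KineticTheory.HeatConduction.pinnedChain ω₂ lam β γ).IsSteadyState N T_L T_R μ → (Literature.MathematicalPhysics.KineticTheory.HeatConduction.pinnedChain ω₂ lam β γ).IsSteadyState N T_L T_R ν → μ = ν) → ∀ μ : (N : ℕ) → ℝ → ℝ → MeasureTheory.Measure (Literature.MathematicalPhysics.KineticTheory.HeatConduction.PhaseSpace N), (∀ (N : ℕ) (T_L T_R : ℝ), 0 < T_L → 0 < T_R → (Literature.MathematicalPhysics.KineticTheory.HeatConduction.pinnedChain ω₂ lam β γ).IsSteadyState N T_L T_R (μ N T_L T_R)) → ∀ T : ℝ, 0 < T → ∀ ℓ : ℕ, ∃ B : ℝ, ∀ (N : ℕ) (i : Fin N) (t : ℝ), (i.val ≤ ℓ ∨ N ≤ i.val + 1 + ℓ)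 → Filter.Tendsto (fun δ : ℝ => ((∫ x, (x.2 i) ^ 2 ∂(μ N (T + δ / 2) (T - δ / 2))) - ∫ x, (x.2 i) ^ 2 ∂(μ N T T)) / δ) (nhdsWithin 0 {(0 : ℝ)}ᶜ) (nhds t) → |t| ≤ B) → (∀ ω₂ lam β γ : ℝ, 0 < ω₂ → 0 < lam → 0 < β → 0 < γ → (∀ (N : ℕ) (T_L T_R : ℝ), 0 < T_L → 0 < T_R → ∀ μ ν : MeasureTheory.Measure (Literature.MathematicalPhysics.KineticTheory.HeatConduction.PhaseSpace N), (Literature.MathematicalPhysics.KineticTheory.HeatConduction.pinnedChain ω₂ lam β γ).IsSteadyState N T_L T_R μ → (Literature.MathematicalPhysics.KineticTheory.HeatConduction.pinnedChain ω₂ lam β γ).IsSteadyState N T_L T_R ν → μ = ν) → ∀ μ : (N : ℕ) → ℝ → ℝ → MeasureTheory.Measure (Literature.MathematicalPhysics.KineticTheory.HeatConduction.PhaseSpace N), (∀ (N : ℕ) (T_L T_R : ℝ), 0 < T_L → 0 < T_R → (Literature.MathematicalPhysics.KineticTheory.HeatConduction.pinnedChain ω₂ lam β γ).IsSteadyState N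 T_L T_R (μ N T_L T_R)) → ∀ T : ℝ, 0 < T → ∃ (ℓ : ℕ) (K : ℝ), ∀ (N : ℕ) (θ : Fin N → ℝ), (∀ i : Fin N, Filter.Tendsto (fun δ : ℝ => ((∫ x, (x.2 i) ^ 2 ∂(μ N (T + δ / 2) (T - δ / 2))) - ∫ x, (x.2 i) ^ 2 ∂(μ N T T)) / δ) (nhdsWithin 0 {(0 : ℝ)}ᶜ) (nhds (θ i))) → ∑ i : Fin N, ∑ j : Fin N, (if j.val = i.val + 1 ∧ ℓ ≤ i.val ∧ i.val + 1 + ℓ < N then max (θ j - θ i) 0 else 0) ≤ K) → (∀ ω₂ lam β γ : ℝ, 0 < ω₂ → 0 < lam → 0 < β → 0 < γ → (∀ (N : ℕ) (T_L T_R : ℝ), 0 < T_L → 0 < T_R → ∀ μ ν : MeasureTheory.Measure (Literature.MathematicalPhysics.KineticTheory.HeatConduction.PhaseSpace N), (Literature.MathematicalPhysics.KineticTheory.HeatConduction.pinnedChain ω₂ lam β γ).IsSteadyState N T_L T_R μ → (Literature.MathematicalPhysics.KineticTheory.HeatConduction.pinnedChain ω₂ lam β γ).IsSteadyState N T_L T_R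 ν → μ = ν) → ∀ μ : (N : ℕ) → ℝ → ℝ → MeasureTheory.Measure (Literature.MathematicalPhysics.KineticTheory.HeatConduction.PhaseSpace N), (∀ (N : ℕ) (T_L T_R : ℝ), 0 < T_L → 0 < T_R → (Literature.MathematicalPhysics.KineticTheory.HeatConduction.pinnedChain ω₂ lam β γ).IsSteadyState N T_L T_R (μ N T_L T_R)) → ∀ T : ℝ, 0 < T → ∃ C : ℝ, ∀ (N : ℕ) (θ : Fin N → ℝ), (∀ i : Fin N, Filter.Tendsto (fun δ : ℝ => ((∫ x, (x.2 i) ^ 2 ∂(μ N (T + δ / 2) (T - δ / 2))) - ∫ x, (x.2 i) ^ 2 ∂(μ N T T)) / δ) (nhdsWithin 0 {(0 : ℝ)}ᶜ) (nhds (θ i))) → ∑ i : Fin N, ∑ j : Fin N, (if j.val = i.val + 1 then |θ j - θ i| else 0) ≤ C) :=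
  fun hBB hBF => bvProfile_of_totalBackflow (totalBackflow_of_boundaryBound_of_backflow hBB hBF)

/-- **The reshaped seam at the crux's name in route `LocalOhmBV`**, unconditionally. [folklore] -/
theorem localOhmBV_bvProfile_of_boundaryBound_of_backflow
    (hBB : ∀ ω₂ lam β γ : ℝ, 0 < ω₂ → 0 < lam → 0 < β → 0 < γ → (∀ (N : ℕ) (T_L T_R : ℝ), 0 < T_L → 0 < T_R → ∀ μ ν : MeasureTheory.Measure (Literature.MathematicalPhysics.KineticTheory.HeatConduction.PhaseSpace N), (Literature.MathematicalPhysics.KineticTheory.HeatConduction.pinnedChain ω₂ lam β γ).IsSteadyState N T_L T_R μ → (Literature.MathematicalPhysics.KineticTheory.HeatConduction.pinnedChain ω₂ lam β γ).IsSteadyState N T_L T_R ν → μ = ν) → ∀ μ : (N : ℕ) → ℝ → ℝ → MeasureTheory.Measure (Literature.MathematicalPhysics.KineticTheory.HeatConduction.PhaseSpace N), (∀ (N : ℕ) (T_L T_R : ℝ), 0 < T_L → 0 < T_R → (Literature.MathematicalPhysics.KineticTheory.HeatConduction.pinnedChain ω₂ lam β γ).IsSteadyState N T_L T_R (μ N T_L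 T_R)) → ∀ T : ℝ, 0 < T → ∀ ℓ : ℕ, ∃ B : ℝ, ∀ (N : ℕ) (i : Fin N) (t : ℝ), (i.val ≤ ℓ ∨ N ≤ i.val + 1 + ℓ) → Filter.Tendsto (fun δ : ℝ => ((∫ x, (x.2 i) ^ 2 ∂(μ N (T + δ / 2) (T - δ / 2))) - ∫ x, (x.2 i) ^ 2 ∂(μ N T T)) / δ) (nhdsWithin 0 {(0 : ℝ)}ᶜ) (nhds t) → |t| ≤ B)
    (hBF : ∀ ω₂ lam β γ : ℝ, 0 < ω₂ → 0 < lam → 0 < β → 0 < γ → (∀ (N : ℕ) (T_L T_R : ℝ), 0 < T_L → 0 < T_R → ∀ μ ν : MeasureTheory.Measure (Literature.MathematicalPhysics.KineticTheory.HeatConduction.PhaseSpace N), (Literature.MathematicalPhysics.KineticTheory.HeatConduction.pinnedChain ω₂ lam β γ).IsSteadyState N T_L T_R μ → (Literature.MathematicalPhysics.KineticTheory.HeatConduction.pinnedChain ω₂ lam β γ).IsSteadyState N T_L T_R ν → μ = ν) → ∀ μ : (N : ℕ) → ℝ → ℝ → MeasureTheory.Measure (Literature.MathematicalPhysics.KineticTheory.HeatConduction.PhaseSpace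 N), (∀ (N : ℕ) (T_L T_R : ℝ), 0 < T_L → 0 < T_R → (Literature.MathematicalPhysics.KineticTheory.HeatConduction.pinnedChain ω₂ lam β γ).IsSteadyState N T_L T_R (μ N T_L T_R)) → ∀ T : ℝ, 0 < T → ∃ (ℓ : ℕ) (K : ℝ), ∀ (N : ℕ) (θ : Fin N → ℝ), (∀ i : Fin N, Filter.Tendsto (fun δ : ℝ => ((∫ x, (x.2 i) ^ 2 ∂(μ N (T + δ / 2) (T - δ / 2))) - ∫ x, (x.2 i) ^ 2 ∂(μ N T T)) / δ) (nhdsWithin 0 {(0 : ℝ)}ᶜ) (nhds (θ i))) → ∑ i : Fin N, ∑ j : Fin N, (if j.val = i.val + 1 ∧ ℓ ≤ i.val ∧ i.val + 1 + ℓ < N then max (θ j - θ i) 0 else 0) ≤ K) :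
    _root_.Summit.AtomisticToContinuum.FouriersLaw.Theses.LocalOhmBV.BVProfile :=
  bvProfile_of_boundaryBound_of_backflow hBB hBF

/-- **The reshaped seam at the crux's sister-route name** (`TransferKernelPositivity.BVProfile`), unconditionally.
[folklore] -/
theorem transferKernelPositivity_bvProfile_of_boundaryBound_of_backflow
    (hBB : ∀ ω₂ lam β γ : ℝ, 0 < ω₂ → 0 < lam → 0 < β → 0 < γ → (∀ (N : ℕ) (T_L T_R : ℝ), 0 < T_L → 0 < T_R → ∀ μ ν : MeasureTheory.Measure (Literature.MathematicalPhysics.KineticTheory.HeatConduction.PhaseSpace N), (Literature.MathematicalPhysics.KineticTheory.HeatConduction.pinnedChain ω₂ lam β γ).IsSteadyState N T_L T_R μ → (Literature.MathematicalPhysics.KineticTheory.HeatConduction.pinnedChain ω₂ lam β γ).IsSteadyState N T_L T_R ν → μ = ν) → ∀ μ : (N : ℕ) → ℝ → ℝ → MeasureTheory.Measure (Literature.MathematicalPhysics.KineticTheory.HeatConduction.PhaseSpace N), (∀ (N : ℕ) (T_L T_R : ℝ), 0 < T_L → 0 < T_R → (Literature.MathematicalPhysics.KineticTheory.HeatConduction.pinnedChain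 ω₂ lam β γ).IsSteadyState N T_L T_R (μ N T_L T_R)) → ∀ T : ℝ, 0 < T → ∀ ℓ : ℕ, ∃ B : ℝ, ∀ (N : ℕ) (i : Fin N) (t : ℝ), (i.val ≤ ℓ ∨ N ≤ i.val + 1 + ℓ) → Filter.Tendsto (fun δ : ℝ => ((∫ x, (x.2 i) ^ 2 ∂(μ N (T + δ / 2) (T - δ / 2))) - ∫ x, (x.2 i) ^ 2 ∂(μ N T T)) / δ) (nhdsWithin 0 {(0 : ℝ)}ᶜ) (nhds t) → |t| ≤ B)
    (hBF : ∀ ω₂ lam β γ : ℝ, 0 < ω₂ → 0 < lam → 0 < β → 0 < γ → (∀ (N : ℕ) (T_L T_R : ℝ), 0 < T_L → 0 < T_R → ∀ μ ν : MeasureTheory.Measure (Literature.MathematicalPhysics.KineticTheory.HeatConduction.PhaseSpace N), (Literature.MathematicalPhysics.KineticTheory.HeatConduction.pinnedChain ω₂ lam β γ).IsSteadyState N T_L T_R μ → (Literature.MathematicalPhysics.KineticTheory.HeatConduction.pinnedChain ω₂ lam β γ).IsSteadyState N T_L T_R ν → μ = ν) → ∀ μ : (N : ℕ) → ℝ → ℝ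 → MeasureTheory.Measure (Literature.MathematicalPhysics.KineticTheory.HeatConduction.PhaseSpace N), (∀ (N : ℕ) (T_L T_R : ℝ), 0 < T_L → 0 < T_R → (Literature.MathematicalPhysics.KineticTheory.HeatConduction.pinnedChain ω₂ lam β γ).IsSteadyState N T_L T_R (μ N T_L T_R)) → ∀ T : ℝ, 0 < T → ∃ (ℓ : ℕ) (K : ℝ), ∀ (N : ℕ) (θ : Fin N → ℝ), (∀ i : Fin N, Filter.Tendsto (fun δ : ℝ => ((∫ x, (x.2 i) ^ 2 ∂(μ N (T + δ / 2) (T - δ / 2))) - ∫ x, (x.2 i) ^ 2 ∂(μ N T T)) / δ) (nhdsWithin 0 {(0 : ℝ)}ᶜ) (nhds (θ i))) → ∑ i : Fin N, ∑ j : Fin N, (if j.val = i.val + 1 ∧ ℓ ≤ i.val ∧ i.val + 1 + ℓ < N then max (θ j - θ i) 0 else 0) ≤ K) :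
    _root_.Summit.AtomisticToContinuum.FouriersLaw.Theses.TransferKernelPositivity.BVProfile :=
  bvProfile_of_boundaryBound_of_backflow hBB hBF

/-- **The everywhere sup bound implies the boundary-layer bound** (old stub `stub_profileBound` ⇒ new stub
`stub_boundaryBound`, same `B` for every width). [folklore] -/
theorem boundaryBound_of_profileBound : (∀ ω₂ lam β γ : ℝ, 0 < ω₂ → 0 < lam → 0 < β → 0 < γ → (∀ (N : ℕ) (T_L T_R : ℝ), 0 < T_L → 0 < T_R → ∀ μ ν : MeasureTheory.Measure (Literature.MathematicalPhysics.KineticTheory.HeatConduction.PhaseSpace N), (Literature.MathematicalPhysics.KineticTheory.HeatConduction.pinnedChain ω₂ lam β γ).IsSteadyState N T_L T_R μ → (Literature.MathematicalPhysics.KineticTheory.HeatConduction.pinnedChain ω₂ lam β γ).IsSteadyState N T_L T_R ν → μ = ν) → ∀ μ : (N : ℕ) → ℝ → ℝ → MeasureTheory.Measure (Literature.MathematicalPhysics.KineticTheory.HeatConduction.PhaseSpace N), (∀ (N : ℕ) (T_L T_R : ℝ), 0 < T_L → 0 < T_R → (Literature.MathematicalPhysics.KineticTheory.HeatConduction.pinnedChain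 ω₂ lam β γ).IsSteadyState N T_L T_R (μ N T_L T_R)) → ∀ T : ℝ, 0 < T → ∃ B : ℝ, ∀ (N : ℕ) (i : Fin N) (t : ℝ), Filter.Tendsto (fun δ : ℝ => ((∫ x, (x.2 i) ^ 2 ∂(μ N (T + δ / 2) (T - δ / 2))) - ∫ x, (x.2 i) ^ 2 ∂(μ N T T)) / δ) (nhdsWithin 0 {(0 : ℝ)}ᶜ) (nhds t) → |t| ≤ B) → (∀ ω₂ lam β γ : ℝ, 0 < ω₂ → 0 < lam → 0 < β → 0 < γ → (∀ (N : ℕ) (T_L T_R : ℝ), 0 < T_L → 0 < T_R → ∀ μ ν : MeasureTheory.Measure (Literature.MathematicalPhysics.KineticTheory.HeatConduction.PhaseSpace N), (Literature.MathematicalPhysics.KineticTheory.HeatConduction.pinnedChain ω₂ lam β γ).IsSteadyState N T_L T_R μ → (Literature.MathematicalPhysics.KineticTheory.HeatConduction.pinnedChain ω₂ lam β γ).IsSteadyState N T_L T_R ν → μ = ν) → ∀ μ : (N : ℕ) → ℝ → ℝ → MeasureTheory.Measure (Literature.MathematicalPhysics.KineticTheory.HeatConduction.PhaseSpace N), (∀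 (N : ℕ) (T_L T_R : ℝ), 0 < T_L → 0 < T_R → (Literature.MathematicalPhysics.KineticTheory.HeatConduction.pinnedChain ω₂ lam β γ).IsSteadyState N T_L T_R (μ N T_L T_R)) → ∀ T : ℝ, 0 < T → ∀ ℓ : ℕ, ∃ B : ℝ, ∀ (N : ℕ) (i : Fin N) (t : ℝ), (i.val ≤ ℓ ∨ N ≤ i.val + 1 + ℓ) → Filter.Tendsto (fun δ : ℝ => ((∫ x, (x.2 i) ^ 2 ∂(μ N (T + δ / 2) (T - δ / 2))) - ∫ x, (x.2 i) ^ 2 ∂(μ N T T)) / δ) (nhdsWithin 0 {(0 : ℝ)}ᶜ) (nhds t) → |t| ≤ B) := by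
  intro hPB ω₂ lam β γ hω hl hβ hγ hU μ hμ T hT ℓ
  obtain ⟨B, hB⟩ := hPB ω₂ lam β γ hω hl hβ hγ hU μ hμ T hT
  exact ⟨B, fun N i t _ ht => hB N i t ht⟩

/-- **The sister crux `Passivity` implies the boundary-layer bound** with `B = 1/2` for every width. [folklore] -/
theorem boundaryBound_of_passivity
    (hP : _root_.Summit.AtomisticToContinuum.FouriersLaw.Theses.TransferKernelPositivity.Passivity) :
    ∀ ω₂ lam β γ : ℝ, 0 < ω₂ → 0 < lam → 0 < β → 0 < γ → (∀ (N : ℕ) (T_L T_R : ℝ), 0 < T_L → 0 < T_R → ∀ μ ν : MeasureTheory.Measure (Literature.MathematicalPhysics.KineticTheory.HeatConduction.PhaseSpace N), (Literature.MathematicalPhysics.KineticTheory.HeatConduction.pinnedChain ω₂ lam β γ).IsSteadyState N T_L T_R μ → (Literature.MathematicalPhysics.KineticTheory.HeatConduction.pinnedChain ω₂ lam β γ).IsSteadyState N T_L T_R ν → μ = ν) → ∀ μ : (N : ℕ) → ℝ → ℝ → MeasureTheory.Measure (Literature.MathematicalPhysics.KineticTheory.HeatConduction.PhaseSpace N), (∀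 (N : ℕ) (T_L T_R : ℝ), 0 < T_L → 0 < T_R → (Literature.MathematicalPhysics.KineticTheory.HeatConduction.pinnedChain ω₂ lam β γ).IsSteadyState N T_L T_R (μ N T_L T_R)) → ∀ T : ℝ, 0 < T → ∀ ℓ : ℕ, ∃ B : ℝ, ∀ (N : ℕ) (i : Fin N) (t : ℝ), (i.val ≤ ℓ ∨ N ≤ i.val + 1 + ℓ) → Filter.Tendsto (fun δ : ℝ => ((∫ x, (x.2 i) ^ 2 ∂(μ N (T + δ / 2) (T - δ / 2))) - ∫ x, (x.2 i) ^ 2 ∂(μ N T T)) / δ) (nhdsWithin 0 {(0 : ℝ)}ᶜ) (nhds t) → |t| ≤ B :=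
  fun ω₂ lam β γ hω hl hβ hγ hU μ hμ T hT _ =>
    ⟨1 / 2, fun N i t _ ht => hP ω₂ lam β γ hω hl hβ hγ hU μ hμ T hT N i t ht⟩

end Summit.AtomisticToContinuum.FouriersLaw.Theorems

end
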